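import Literature.NumberTheory.EllipticCurves.TateCurve.UniformizationHolds
import Literature.NumberTheory.EllipticCurves.GaloisActionProofs
import HarnessLib

/-!
# The `N`-torsion of the Tate curve as a Galois module: `0 → μ_N → E_q[N] → ℤ/N → 0`, with kernel
# of the action `G_{K_N}`, `K_N = K(μ_N, q^{1/N})` (Silverman, *Advanced Topics*, V §3; [EtTh] §1 p. 13)

Topic `Literature/NumberTheory/EllipticCurves/TateCurve`, namespace
`Literature.NumberTheory.EllipticCurves.TateCurve` (abc-iut cell, layer L2 row «TATE-CURVE N-TORSION
KUMMER EXTENSION», L2-lead rulings #2 (R21); seat abc-iut-L2-t5). PROOF-ONLY (no definition, no named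
fact): everything here is a consequence of Tate's uniformisation `φ : K̄^*/q^ℤ ⥲ E_q(K̄)`,
`G_K`-equivariant — the tree's THEOREM `uniformization_holds` (`UniformizationHolds.lean`, Silverman
ATAEC Thm. V.3.1 (c),(d)) — read on the `N`-torsion.

Silverman, *Advanced Topics in the Arithmetic of Elliptic Curves*, V §3 (PDF pp. 394–399) and the proof of
Lemma V.5.2: since `φ` is a `G_K`-isomorphism `K̄^*/q^ℤ ⥲ E_q(K̄)`, `E_q[N] ≅ {u : u^N ∈ q^ℤ}/q^ℤ` is
generated by a primitive `N`-th root of unity `ζ_N` and `Q = q^{1/N}`: an exact sequence of `G_K`-modules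
`0 → μ_N → E_q[N] → ℤ/Nℤ → 0` whose extension class is the Kummer class of `q`; in the basis
`(φ(ζ_N), φ(Q))`, `σ ∈ G_K` acts by `((χ_N(σ), κ_q(σ)), (0, 1))` (`σ ζ_N = ζ_N^{χ_N(σ)}`,
`σ Q = ζ_N^{κ_q(σ)} Q`), so the kernel of `G_K → Aut(E_q[N])` is `G_{K_N}`, `K_N := K(μ_N, q^{1/N})`.

This is the classical (abelian-variety) side of S. Mochizuki, *The étale theta function …* [EtTh] §1,
PRIMS PDF p. 13: "set `K_N := K(ζ_N, q_X^{1/N}) ⊆ K̄` … [Indeed, this follows from the fact that `G_{K_N}`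
acts trivially on `(Δ^tp_X)^ell/N·(Δ^tp_Y)^ell`.]" — typed in layer L2 as `Setting.fieldKN K q N =
K(x : x^N = 1 ∨ x^N = q)` and as the `∀ N` Tate clause of the GENUINE-model origin predicates
(`ThetaSetting.IsTateOrigin`, abc-iut-L2-t6). HONEST FRAMING: CLASSICAL SUPPORT for such a genuine-model
clause (Tate curve over a complete field, not tempered fundamental groups); it says nothing about the
degenerate root model of the §1 setting, asserts nothing of [EtTh], takes no side on [IUTchIII] Cor. 3.12.

Contents (`K` complete ultrametric of characteristic `0`, `0 < ‖q‖ < 1`, `K̄ = AlgebraicClosure K` with its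
`G_K = Field.absoluteGaloisGroup K`-action, `E_q[N] = geomTorsion (tateCurve q) N`, `0 < N`): an ENGINE over an
abstract `G_K`-module `M` uniformised by a surjective equivariant `φ : K̄^* →+ M` with kernel `q^ℤ` (the
clauses of `uniformization`) — torsion criterion, faithfulness lemma, its converse, basis/matrix description;
then `mem_ker_galoisRepTorsion_tateCurve_iff` (**`σ ∈ Ker(G_K → Aut E_q[N]) ↔ σ` fixes every `x ∈ K̄` with
`x^N = 1` or `x^N = q`**), `ker_galoisRepTorsion_tateCurve_eq` (the same against the fixing subgroup of
`K(x : x^N = 1 ∨ x^N = q)`, the generator set of L2's `fieldKN`), `exists_basis_galoisRepTorsion_tateCurve`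
(**`E_q[N] = ℤ/N·P₁ ⊕ ℤ/N·P₂`**, `P₁ = φ(ζ_N)`, `P₂ = φ(q^{1/N})`, relations exactly `N ∣ a ∧ N ∣ b`,
triangular action `σ•P₁ = χ•P₁`, `σ•P₂ = P₂ + κ•P₁` whenever `σ ζ = ζ^χ`, `σ Q = ζ^κ Q`).

References: [SilvermanATAEC1994] J. H. Silverman, *Advanced Topics in the Arithmetic of Elliptic Curves*,
GTM 151 (1994), Thm. V.3.1 (c),(d) (PDF pp. 394–399), Lemma V.5.2 (PDF p. 406); [MochizukiEtTh2009]
S. Mochizuki, *The étale theta function …*, Publ. RIMS 45 (2009), §1 p. 13 (PRIMS PDF) — consumer context only.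
-/

noncomputable section

open scoped Classical

open Field WeierstrassCurve

namespace Literature.NumberTheory.EllipticCurves.TateCurve

open SteinWuthrich2013

universe u v

/-! ### Engine: the `N`-torsion of a `G_K`-module uniformised by `K̄^*/q^ℤ` -/

section Engine

variable {K : Type u} [NormedField K] {q : K} {M : Type v} [AddCommGroup M]
  {φ : Additive (AlgebraicClosure K)ˣ →+ M}

/-- `N • φ(u) = φ(u^N)` for an additive `φ` on `K̄^*` written additively. [folklore] -/
private theorem natCast_zsmul_phi_eq (φ : Additive (AlgebraicClosure K)ˣ →+ M) (u : (AlgebraicClosure K)ˣ)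
    (N : ℕ) : ((N : ℕ) : ℤ) • φ (Additive.ofMul u) = φ (Additive.ofMul (u ^ N)) := by
  rw [← map_zsmul φ, ← zpow_natCast, ofMul_zpow]

/-- **Torsion criterion** (Silverman ATAEC V §3, proof of V.5.2): if `Ker φ = q^ℤ` then
`N • φ(u) = 0 ↔ u^N ∈ q^ℤ`. [cite: SilvermanATAEC1994, Thm. V.3.1 (c) (PDF p. 395)] -/
theorem zsmul_phi_eq_zero_iff
    (hker : ∀ u : (AlgebraicClosure K)ˣ, φ (Additive.ofMul u) = 0 ↔
      ∃ n : ℤ, (u : AlgebraicClosure K) = algebraMap K (AlgebraicClosure K) q ^ n)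
    (u : (AlgebraicClosure K)ˣ) (N : ℕ) :
    ((N : ℕ) : ℤ) • φ (Additive.ofMul u) = 0 ↔
      ∃ k : ℤ, (u : AlgebraicClosure K) ^ N = algebraMap K (AlgebraicClosure K) q ^ k := by
  rw [natCast_zsmul_phi_eq, hker, Units.val_pow_eq_pow_val]

/-- An element of `K̄` which is an `N`-th root of `1` or of `q ≠ 0` is nonzero (`0 < N`). [folklore] -/
private theorem ne_zero_of_pow_eq_one_or (hq0 : q ≠ 0) {N : ℕ} (hN : 0 < N) {x : AlgebraicClosure K}
    (hx : x ^ N = 1 ∨ x ^ N = algebraMap K (AlgebraicClosure K) q) : x ≠ 0 := by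
  rintro rfl
  rw [zero_pow hN.ne'] at hx
  rcases hx with hx | hx
  · exact zero_ne_one hx
  · exact (_root_.map_ne_zero (algebraMap K (AlgebraicClosure K))).mpr hq0 hx.symm

/-- `q^k = 1` in `K̄` forces `k = 0` when `0 < ‖q‖ < 1`. [cite: SilvermanATAEC1994, Thm. V.3.1 (d) (proof, PDF p. 399)] -/
theorem zpow_algebraMap_eq_one_iff (hq0 : q ≠ 0) (hq : ‖q‖ < 1) (k : ℤ) :
    algebraMap K (AlgebraicClosure K) q ^ k = 1 ↔ k = 0 := by
  refine ⟨fun h => ?_, fun h => by rw [h, zpow_zero]⟩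
  have h' : algebraMap K (AlgebraicClosure K) q ^ k = algebraMap K (AlgebraicClosure K) q ^ (0 : ℤ) := by
    rw [h, zpow_zero]
  exact zpow_algebraMap_injective hq0 hq h'

variable [DistribMulAction (absoluteGaloisGroup K) M]

/-- **Faithfulness** (the `⊆` half of `Ker(G_K → Aut E_q[N]) = G_{K_N}`): if `σ ∈ G_K` fixes every
`N`-torsion element of `M`, then `σ` fixes every `N`-th root of `1` and every `N`-th root of `q` in
`K̄` — because `φ(σx)/φ(x) = φ(σx·x⁻¹) = 0` forces `σx·x⁻¹ ∈ q^ℤ ∩ μ_N = {1}` (`‖q‖ < 1`).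
[cite: SilvermanATAEC1994, Thm. V.3.1 (c),(d) (PDF pp. 395–399)] -/
theorem smul_eq_self_of_forall_torsion_smul_eq (hq0 : q ≠ 0) (hq : ‖q‖ < 1)
    (hker : ∀ u : (AlgebraicClosure K)ˣ, φ (Additive.ofMul u) = 0 ↔
      ∃ n : ℤ, (u : AlgebraicClosure K) = algebraMap K (AlgebraicClosure K) q ^ n)
    (hequiv : ∀ (σ : absoluteGaloisGroup K) (u : (AlgebraicClosure K)ˣ),
      σ • φ (Additive.ofMul u) = φ (Additive.ofMul (Units.map
        (absoluteGaloisGroup.toAlgEquiv K σ : AlgebraicClosure K →* AlgebraicClosure K) u)))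
    {N : ℕ} (hN : 0 < N) (σ : absoluteGaloisGroup K)
    (hσ : ∀ P : M, ((N : ℕ) : ℤ) • P = 0 → σ • P = P)
    (x : AlgebraicClosure K) (hx : x ^ N = 1 ∨ x ^ N = algebraMap K (AlgebraicClosure K) q) :
    σ • x = x := by
  have hx0 : x ≠ 0 := ne_zero_of_pow_eq_one_or hq0 hN hx
  have hqb0 : algebraMap K (AlgebraicClosure K) q ≠ 0 := (_root_.map_ne_zero _).mpr hq0
  set u : (AlgebraicClosure K)ˣ := Units.mk0 x hx0 with hu
  -- `φ(u)` is `N`-torsion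
  have htors : ((N : ℕ) : ℤ) • φ (Additive.ofMul u) = 0 := by
    rw [zsmul_phi_eq_zero_iff hker]
    rcases hx with hx | hx
    · exact ⟨0, by rw [zpow_zero]; exact hx⟩
    · exact ⟨1, by rw [zpow_one]; exact hx⟩
  -- hence fixed by `σ`: `φ(σu · u⁻¹) = 0`
  have hfix := hσ _ htors
  rw [hequiv] at hfix
  set v : (AlgebraicClosure K)ˣ :=
    Units.map (absoluteGaloisGroup.toAlgEquiv K σ : AlgebraicClosure K →* AlgebraicClosure K) u with hv
  have h0 : φ (Additive.ofMul (v * u⁻¹)) = 0 := by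
    rw [ofMul_mul, ofMul_inv, map_add, map_neg, hfix, add_neg_cancel]
  obtain ⟨k, hk⟩ := (hker _).mp h0
  -- `(σx · x⁻¹)^N = σ(x^N) · (x^N)⁻¹ = 1`
  have hxN : absoluteGaloisGroup.toAlgEquiv K σ (x ^ N) = x ^ N := by
    rcases hx with hx | hx
    · rw [hx, map_one]
    · rw [hx, AlgEquiv.commutes]
  have hvN : ((v * u⁻¹ : (AlgebraicClosure K)ˣ) : AlgebraicClosure K) ^ N = 1 := by
    rw [Units.val_mul, mul_pow, Units.val_inv_eq_inv_val, inv_pow]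
    change (absoluteGaloisGroup.toAlgEquiv K σ x) ^ N * (x ^ N)⁻¹ = 1
    rw [← map_pow, hxN, mul_inv_cancel₀ (pow_ne_zero _ hx0)]
  -- so `q^{kN} = 1`, `k = 0`, `σx = x`
  have hkN : algebraMap K (AlgebraicClosure K) q ^ (k * N) = 1 := by
    rw [zpow_mul, zpow_natCast, ← hk, hvN]
  have hk0 : k = 0 := by
    have := (zpow_algebraMap_eq_one_iff hq0 hq _).mp hkN
    rcases mul_eq_zero.mp this with h | h
    · exact h
    · exact absurd h (by exact_mod_cast hN.ne')
  rw [hk0, zpow_zero] at hk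
  have hvu : (v : AlgebraicClosure K) = u := by
    have := congrArg (· * (u : AlgebraicClosure K)) hk
    simpa [Units.val_mul, mul_assoc, u.inv_mul] using this
  rw [absoluteGaloisGroup.smul_def]
  simpa [hv, hu] using hvu

/-- **Triviality on `G_{K_N}`** (the `⊇` half): if `σ ∈ G_K` fixes every `N`-th root of `1` and of `q`
in `K̄`, then `σ` fixes every `N`-torsion element of `M` — every `u` with `u^N = q^k` is
`(u·Q^{-k})·Q^k` with `u·Q^{-k} ∈ μ_N`, `Q = q^{1/N}`. ("`G_{K_N}` acts trivially", [EtTh] p. 13, on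
the Tate-curve side.) [cite: SilvermanATAEC1994, Thm. V.3.1 (c),(d) (PDF pp. 395–399)] -/
theorem torsion_smul_eq_of_forall_root_smul_eq (hq0 : q ≠ 0) (hsurj : Function.Surjective φ)
    (hker : ∀ u : (AlgebraicClosure K)ˣ, φ (Additive.ofMul u) = 0 ↔
      ∃ n : ℤ, (u : AlgebraicClosure K) = algebraMap K (AlgebraicClosure K) q ^ n)
    (hequiv : ∀ (σ : absoluteGaloisGroup K) (u : (AlgebraicClosure K)ˣ),
      σ • φ (Additive.ofMul u) = φ (Additive.ofMul (Units.map
        (absoluteGaloisGroup.toAlgEquiv K σ : AlgebraicClosure K →* AlgebraicClosure K) u)))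
    {N : ℕ} (hN : 0 < N) (σ : absoluteGaloisGroup K)
    (hσ : ∀ x : AlgebraicClosure K,
      (x ^ N = 1 ∨ x ^ N = algebraMap K (AlgebraicClosure K) q) → σ • x = x)
    (P : M) (hP : ((N : ℕ) : ℤ) • P = 0) : σ • P = P := by
  have hqb0 : algebraMap K (AlgebraicClosure K) q ≠ 0 := (_root_.map_ne_zero _).mpr hq0
  obtain ⟨a, rfl⟩ := hsurj P
  obtain ⟨u, rfl⟩ : ∃ u : (AlgebraicClosure K)ˣ, Additive.ofMul u = a := ⟨Additive.toMul a, rfl⟩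
  obtain ⟨k, hk⟩ := (zsmul_phi_eq_zero_iff hker u N).mp hP
  -- an `N`-th root `Q` of `q`, fixed by `σ`
  obtain ⟨Q, hQ⟩ := IsAlgClosed.exists_pow_nat_eq (algebraMap K (AlgebraicClosure K) q) hN
  have hQ0 : Q ≠ 0 := ne_zero_of_pow_eq_one_or hq0 hN (Or.inr hQ)
  have hσQ : absoluteGaloisGroup.toAlgEquiv K σ Q = Q := by
    rw [← absoluteGaloisGroup.smul_def]; exact hσ Q (Or.inr hQ)
  -- `w := u · Q^{-k}` is an `N`-th root of unity, fixed by `σ`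
  set w : AlgebraicClosure K := (u : AlgebraicClosure K) * (Q ^ k)⁻¹ with hw
  have hQkN : (Q ^ k) ^ N = algebraMap K (AlgebraicClosure K) q ^ k := by
    rw [← zpow_natCast, ← zpow_mul, mul_comm, zpow_mul, zpow_natCast, hQ]
  have hwN : w ^ N = 1 := by
    rw [hw, mul_pow, inv_pow, hk, hQkN, mul_inv_cancel₀ (zpow_ne_zero k hqb0)]
  have hσw : absoluteGaloisGroup.toAlgEquiv K σ w = w := by
    rw [← absoluteGaloisGroup.smul_def]; exact hσ w (Or.inl hwN)
  have huw : (u : AlgebraicClosure K) = w * Q ^ k := by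
    rw [hw, inv_mul_cancel_right₀ (zpow_ne_zero k hQ0)]
  have hσu : absoluteGaloisGroup.toAlgEquiv K σ (u : AlgebraicClosure K) = u := by
    rw [huw, map_mul, map_zpow₀, hσw, hσQ]
  have hmap : Units.map (absoluteGaloisGroup.toAlgEquiv K σ : AlgebraicClosure K →* AlgebraicClosure K) u
      = u := Units.ext hσu
  rw [hequiv, hmap]

/-- **The basis `(φ(ζ_N), φ(q^{1/N}))` of the `N`-torsion and the triangular Galois action**
(Silverman ATAEC V §3 / proof of V.5.2: `0 → μ_N → E_q[N] → ℤ/N → 0`, extension class = the Kummer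
class of `q`): for a primitive `N`-th root of unity `ζ` and `Q` with `Q^N = q`, the points
`P₁ := φ(ζ)`, `P₂ := φ(Q)` are `N`-torsion, every `N`-torsion element is `a•P₁ + b•P₂`, the only
relations are `N ∣ a ∧ N ∣ b`, and `σ•P₁ = χ•P₁`, `σ•P₂ = P₂ + κ•P₁` whenever `σζ = ζ^χ`,
`σQ = ζ^κ·Q`. [cite: SilvermanATAEC1994, Thm. V.3.1 (c),(d), Lemma V.5.2 (PDF pp. 395–399, 406)] -/
theorem exists_basis_of_uniformization (hq0 : q ≠ 0) (hq : ‖q‖ < 1) (hsurj : Function.Surjective φ)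
    (hker : ∀ u : (AlgebraicClosure K)ˣ, φ (Additive.ofMul u) = 0 ↔
      ∃ n : ℤ, (u : AlgebraicClosure K) = algebraMap K (AlgebraicClosure K) q ^ n)
    (hequiv : ∀ (σ : absoluteGaloisGroup K) (u : (AlgebraicClosure K)ˣ),
      σ • φ (Additive.ofMul u) = φ (Additive.ofMul (Units.map
        (absoluteGaloisGroup.toAlgEquiv K σ : AlgebraicClosure K →* AlgebraicClosure K) u)))
    {N : ℕ} (hN : 0 < N) {ζ Q : AlgebraicClosure K} (hζ : IsPrimitiveRoot ζ N)
    (hQ : Q ^ N = algebraMap K (AlgebraicClosure K) q) :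
    ∃ P₁ P₂ : M, ((N : ℕ) : ℤ) • P₁ = 0 ∧ ((N : ℕ) : ℤ) • P₂ = 0 ∧
      (∀ P : M, ((N : ℕ) : ℤ) • P = 0 → ∃ a b : ℤ, P = a • P₁ + b • P₂) ∧
      (∀ a b : ℤ, a • P₁ + b • P₂ = 0 ↔ ((N : ℕ) : ℤ) ∣ a ∧ ((N : ℕ) : ℤ) ∣ b) ∧
      (∀ (σ : absoluteGaloisGroup K) (c : ℕ), σ • ζ = ζ ^ c → σ • P₁ = c • P₁) ∧
      (∀ (σ : absoluteGaloisGroup K) (d : ℕ), σ • Q = ζ ^ d * Q → σ • P₂ = P₂ + d • P₁) := by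
  haveI : NeZero N := ⟨hN.ne'⟩
  have hqb0 : algebraMap K (AlgebraicClosure K) q ≠ 0 := (_root_.map_ne_zero _).mpr hq0
  have hζ0 : ζ ≠ 0 := hζ.ne_zero hN.ne'
  have hQ0 : Q ≠ 0 := ne_zero_of_pow_eq_one_or hq0 hN (Or.inr hQ)
  set ζu : (AlgebraicClosure K)ˣ := Units.mk0 ζ hζ0 with hζu
  set Qu : (AlgebraicClosure K)ˣ := Units.mk0 Q hQ0 with hQu
  -- the two generators and the value of `φ` on monomials `ζ^a Q^b`
  set P₁ : M := φ (Additive.ofMul ζu) with hP₁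
  set P₂ : M := φ (Additive.ofMul Qu) with hP₂
  have hmon : ∀ a b : ℤ, φ (Additive.ofMul (ζu ^ a * Qu ^ b)) = a • P₁ + b • P₂ := by
    intro a b
    rw [ofMul_mul, map_add, ofMul_zpow, ofMul_zpow, map_zsmul, map_zsmul]
  have hQbN : ∀ b : ℤ, (Q ^ b) ^ N = algebraMap K (AlgebraicClosure K) q ^ b := fun b => by
    rw [← zpow_natCast, ← zpow_mul, mul_comm, zpow_mul, zpow_natCast, hQ]
  have hζaN : ∀ a : ℤ, (ζ ^ a) ^ N = 1 := fun a => by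
    rw [← zpow_natCast, ← zpow_mul, mul_comm, zpow_mul, zpow_natCast, hζ.pow_eq_one, one_zpow]
  refine ⟨P₁, P₂, ?_, ?_, ?_, ?_, ?_, ?_⟩
  · -- `N • P₁ = 0`
    rw [hP₁, zsmul_phi_eq_zero_iff hker]
    exact ⟨0, by rw [zpow_zero, hζu, Units.val_mk0, hζ.pow_eq_one]⟩
  · -- `N • P₂ = 0`
    rw [hP₂, zsmul_phi_eq_zero_iff hker]
    exact ⟨1, by rw [zpow_one, hQu, Units.val_mk0, hQ]⟩
  · -- generation
    intro P hP
    obtain ⟨x, rfl⟩ := hsurj P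
    obtain ⟨u, rfl⟩ : ∃ u : (AlgebraicClosure K)ˣ, Additive.ofMul u = x := ⟨Additive.toMul x, rfl⟩
    obtain ⟨k, hk⟩ := (zsmul_phi_eq_zero_iff hker u N).mp hP
    -- `w := u Q^{-k} ∈ μ_N`, hence a power of `ζ`
    have hwN : ((u * (Qu ^ k)⁻¹ : (AlgebraicClosure K)ˣ) : AlgebraicClosure K) ^ N = 1 := by
      rw [Units.val_mul, Units.val_inv_eq_inv_val, Units.val_zpow_eq_zpow_val, hQu, Units.val_mk0,
        mul_pow, inv_pow, hk, hQbN, mul_inv_cancel₀ (zpow_ne_zero k hqb0)]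
    obtain ⟨i, -, hi⟩ := hζ.eq_pow_of_pow_eq_one hwN
    have hu : u = ζu ^ (i : ℤ) * Qu ^ k := by
      rw [zpow_natCast]
      have : ζu ^ i = u * (Qu ^ k)⁻¹ := Units.ext (by
        rw [Units.val_pow_eq_pow_val, hζu, Units.val_mk0, hi])
      rw [this, inv_mul_cancel_right]
    exact ⟨i, k, by rw [hu, hmon]⟩
  · -- relations
    intro a b
    constructor
    · intro hab
      rw [← hmon, hker] at hab
      obtain ⟨k, hk⟩ := hab
      rw [Units.val_mul, Units.val_zpow_eq_zpow_val, Units.val_zpow_eq_zpow_val, hζu, hQu,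
        Units.val_mk0, Units.val_mk0] at hk
      -- raise to the `N`-th power: `q^b = q^{kN}`
      have hbk : algebraMap K (AlgebraicClosure K) q ^ b =
          algebraMap K (AlgebraicClosure K) q ^ (k * N) := by
        have := congrArg (· ^ N) hk
        simp only [mul_pow, hζaN, hQbN, one_mul] at this
        rwa [← zpow_natCast (algebraMap K (AlgebraicClosure K) q ^ k), ← zpow_mul] at this
      have hb : b = k * N := zpow_algebraMap_injective hq0 hq hbk
      refine ⟨?_, ⟨k, by rw [hb, mul_comm]⟩⟩
      -- then `ζ^a = 1`
      have hQb : Q ^ b = algebraMap K (AlgebraicClosure K) q ^ k := by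
        rw [hb, mul_comm, zpow_mul, zpow_natCast, hQ]
      rw [hQb] at hk
      have hζa : ζ ^ a = 1 := by
        have := mul_right_cancel₀ (zpow_ne_zero k hqb0) (hk.trans (one_mul _).symm)
        exact this
      exact (hζ.zpow_eq_one_iff_dvd a).mp hζa
    · rintro ⟨⟨a', rfl⟩, ⟨b', rfl⟩⟩
      have h1 : ((N : ℕ) : ℤ) • P₁ = 0 := by
        rw [hP₁, zsmul_phi_eq_zero_iff hker]
        exact ⟨0, by rw [zpow_zero, hζu, Units.val_mk0, hζ.pow_eq_one]⟩
      have h2 : ((N : ℕ) : ℤ) • P₂ = 0 := by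
        rw [hP₂, zsmul_phi_eq_zero_iff hker]
        exact ⟨1, by rw [zpow_one, hQu, Units.val_mk0, hQ]⟩
      rw [mul_comm _ a', mul_comm _ b', mul_zsmul, mul_zsmul, h1, h2, zsmul_zero, zsmul_zero,
        add_zero]
  · -- action on `P₁`: the cyclotomic character
    intro σ c hc
    have hmap : Units.map (absoluteGaloisGroup.toAlgEquiv K σ : AlgebraicClosure K →* AlgebraicClosure K)
        ζu = ζu ^ c := Units.ext (by
      rw [Units.val_pow_eq_pow_val, hζu]
      change absoluteGaloisGroup.toAlgEquiv K σ ζ = ζ ^ c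
      rw [← absoluteGaloisGroup.smul_def, hc])
    rw [hP₁, hequiv, hmap, ofMul_pow, map_nsmul]
  · -- action on `P₂`: the Kummer cocycle of `q`
    intro σ d hd
    have hmap : Units.map (absoluteGaloisGroup.toAlgEquiv K σ : AlgebraicClosure K →* AlgebraicClosure K)
        Qu = ζu ^ d * Qu := Units.ext (by
      rw [Units.val_mul, Units.val_pow_eq_pow_val, hζu, hQu]
      change absoluteGaloisGroup.toAlgEquiv K σ Q = ζ ^ d * Q
      rw [← absoluteGaloisGroup.smul_def, hd])
    rw [hP₂, hequiv, hmap, ofMul_mul, map_add, ofMul_pow, map_nsmul, add_comm]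

end Engine

/-! ### The Tate curve `E_q`: `Ker(G_K → Aut E_q[N]) = G_{K_N}` and the basis of `E_q[N]` -/

section TateCurve

variable {K : Type u} [NontriviallyNormedField K] [CompleteSpace K] [IsUltrametricDist K] [CharZero K]
  (q : K) (hq0 : q ≠ 0) (hq : ‖q‖ < 1)

/-- Membership in the geometric `n`-torsion `E[n] = E(K̄)[n]`: `P ∈ E[n] ↔ n • P = 0`. [folklore] -/
private theorem mem_geomTorsion_iff {F : Type u} [Field F] (W : WeierstrassCurve F) (n : ℤ) (P : geomPoints W) :
    P ∈ geomTorsion W n ↔ n • P = 0 := Submodule.mem_torsionBy_iff n P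

/-- `σ ∈ Ker(ρ̄_{E,n})` iff `σ` fixes every `n`-torsion geometric point. [folklore] -/
private theorem mem_ker_galoisRepTorsion_iff {F : Type u} [Field F] (W : WeierstrassCurve F) (n : ℤ)
    (σ : absoluteGaloisGroup F) :
    σ ∈ (galoisRepTorsion W n).ker ↔ ∀ P : geomPoints W, n • P = 0 → σ • P = P := by
  have h := Set.ext_iff.1 (coe_ker_galoisRepTorsion W n) σ
  simp only [SetLike.mem_coe, Set.mem_iInter, MulAction.mem_stabilizer_iff] at h
  rw [h]
  constructor
  · intro h' P hP
    exact h' ⟨P, (mem_geomTorsion_iff W n P).2 hP⟩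
  · intro h' P
    exact h' P ((mem_geomTorsion_iff W n P).1 P.2)

include hq0 hq in
/-- **`Ker(G_K → Aut E_q[N](K̄)) = G_{K_N}`, `K_N = K(μ_N, q^{1/N})`** (Silverman ATAEC V §3 from
Thm. V.3.1 (c),(d); the Tate-curve side of [EtTh] §1 p. 13 "`G_{K_N}` acts trivially on
`(Δ^tp_X)^ell/N·(Δ^tp_Y)^ell`", `K_N := K(ζ_N, q_X^{1/N})`): for `0 < N`, an element `σ` of the
absolute Galois group of the complete field `K` acts trivially on the `N`-torsion of the Tate curve
`E_q` over `K̄` if and only if it fixes every `N`-th root of unity and every `N`-th root of `q` in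
`K̄`. Classical support for a GENUINE-model origin clause; nothing of [EtTh] is asserted.
[cite: SilvermanATAEC1994, Thm. V.3.1 (c),(d) (PDF pp. 395–399)] -/
theorem mem_ker_galoisRepTorsion_tateCurve_iff {N : ℕ} (hN : 0 < N) (σ : absoluteGaloisGroup K) :
    σ ∈ (galoisRepTorsion (tateCurve q) (N : ℤ)).ker ↔
      ∀ x : AlgebraicClosure K,
        (x ^ N = 1 ∨ x ^ N = algebraMap K (AlgebraicClosure K) q) → σ • x = x := by
  obtain ⟨φ, hsurj, hker, hequiv, -⟩ := uniformization_holds q hq0 hq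
  rw [mem_ker_galoisRepTorsion_iff]
  exact ⟨fun h => smul_eq_self_of_forall_torsion_smul_eq hq0 hq hker hequiv hN σ h,
    fun h => torsion_smul_eq_of_forall_root_smul_eq hq0 hsurj hker hequiv hN σ h⟩

include hq0 hq in
/-- **`Ker(G_K → Aut E_q[N](K̄))` is the fixing subgroup of `K_N = K(x : x^N = 1 ∨ x^N = q)`** — the
generator set of layer L2's `Setting.fieldKN` ([EtTh] §1 p. 13 "`K_N := K(ζ_N, q_X^{1/N}) ⊆ K̄`"),
read over an abstract complete ultrametric `K` of characteristic `0` through the identity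
`absoluteGaloisGroup.toAlgEquiv K : G_K ≃* (K̄ ≃ₐ[K] K̄)`. [cite: SilvermanATAEC1994, Thm. V.3.1 (c),(d) (PDF pp. 395–399)] -/
theorem ker_galoisRepTorsion_tateCurve_eq {N : ℕ} (hN : 0 < N) :
    (galoisRepTorsion (tateCurve q) (N : ℤ)).ker =
      ((IntermediateField.adjoin K
          {x : AlgebraicClosure K | x ^ N = 1 ∨ x ^ N = algebraMap K (AlgebraicClosure K) q}).fixingSubgroup).comap
        (absoluteGaloisGroup.toAlgEquiv K).toMonoidHom := by
  ext σ
  rw [mem_ker_galoisRepTorsion_tateCurve_iff q hq0 hq hN, Subgroup.mem_comap,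
    MulEquiv.coe_toMonoidHom, IntermediateField.mem_fixingSubgroup_iff]
  simp only [absoluteGaloisGroup.smul_def]
  constructor
  · intro h x hx
    induction hx using IntermediateField.adjoin_induction with
    | mem x hx => exact h x hx
    | algebraMap x => exact AlgEquiv.commutes _ x
    | add x y _ _ ihx ihy => rw [map_add, ihx, ihy]
    | inv x _ ihx => rw [map_inv₀, ihx]
    | mul x y _ _ ihx ihy => rw [map_mul, ihx, ihy]
  · intro h x hx
    exact h x (IntermediateField.subset_adjoin K _ hx)

include hq0 hq in
/-- **`E_q[N](K̄) = ℤ/N·φ(ζ_N) ⊕ ℤ/N·φ(q^{1/N})` with the triangular Galois action** (Silverman ATAEC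
V §3, proof of Lemma V.5.2; "`0 → μ_N → E_q[N] → ℤ/Nℤ → 0`", extension class = the Kummer class of
`q`): for `0 < N` there are a primitive `N`-th root of unity `ζ ∈ K̄`, an `N`-th root `Q` of `q`, and
`N`-torsion points `P₁, P₂` of `E_q(K̄)` such that every `N`-torsion point is `a•P₁ + b•P₂`, the only
relations are `N ∣ a ∧ N ∣ b` (so `#E_q[N] = N²` with basis `(P₁, P₂)`), `σ•P₁ = χ•P₁` whenever
`σζ = ζ^χ` (the span of `P₁` is a copy of `μ_N`), and `σ•P₂ = P₂ + κ•P₁` whenever `σQ = ζ^κ·Q`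
(the quotient is `ℤ/N` with trivial action; the off-diagonal entry is the Kummer cocycle of `q`).
Classical support for a GENUINE-model origin clause ([EtTh] §1 p. 13); nothing of [EtTh] is asserted.
[cite: SilvermanATAEC1994, Thm. V.3.1 (c),(d), Lemma V.5.2 (PDF pp. 395–399, 406)] -/
theorem exists_basis_galoisRepTorsion_tateCurve {N : ℕ} (hN : 0 < N) :
    ∃ (ζ Q : AlgebraicClosure K) (P₁ P₂ : geomPoints (tateCurve q)),
      IsPrimitiveRoot ζ N ∧ Q ^ N = algebraMap K (AlgebraicClosure K) q ∧
      (N : ℤ) • P₁ = 0 ∧ (N : ℤ) • P₂ = 0 ∧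
      (∀ P : geomPoints (tateCurve q), (N : ℤ) • P = 0 → ∃ a b : ℤ, P = a • P₁ + b • P₂) ∧
      (∀ a b : ℤ, a • P₁ + b • P₂ = 0 ↔ (N : ℤ) ∣ a ∧ (N : ℤ) ∣ b) ∧
      (∀ (σ : absoluteGaloisGroup K) (c : ℕ), σ • ζ = ζ ^ c → σ • P₁ = c • P₁) ∧
      (∀ (σ : absoluteGaloisGroup K) (d : ℕ), σ • Q = ζ ^ d * Q → σ • P₂ = P₂ + d • P₁) := by
  obtain ⟨φ, hsurj, hker, hequiv, -⟩ := uniformization_holds q hq0 hq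
  haveI : NeZero N := ⟨hN.ne'⟩
  haveI : CharZero (AlgebraicClosure K) :=
    charZero_of_injective_algebraMap (algebraMap K (AlgebraicClosure K)).injective
  obtain ⟨ζ, hζ⟩ := HasEnoughRootsOfUnity.exists_primitiveRoot (AlgebraicClosure K) N
  obtain ⟨Q, hQ⟩ := IsAlgClosed.exists_pow_nat_eq (algebraMap K (AlgebraicClosure K) q) hN
  obtain ⟨P₁, P₂, h⟩ := exists_basis_of_uniformization hq0 hq hsurj hker hequiv hN hζ hQ
  exact ⟨ζ, Q, P₁, P₂, hζ, hQ, h⟩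

end TateCurve

end Literature.NumberTheory.EllipticCurves.TateCurve

end
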